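import Summits.Ventures.YMGap.RobustBall.RobustAreaLawBall
import HarnessLib

/-!
# Robust ball (Y2), area-law side, part 7 — certified SU(2), d = 4 AREA-LAW ROWS on the ball

HONEST FRAMING: venture file of the cell `pub-ymgap` (QuantumFields programme), track ROBUST-BALL.  ROWS of the ball area law
(`areaLawOnBall_of_oneLinkKRModulus`, slice dimension `n = 3`) for `SU(2)`, `d = 4` with the tree's unit-ball quarter modulus `K = 1` (radius `≤ 1`,
`SlabAreaLawDimensions.su2_oneLinkKRModulus_of_le_one`, valid up to `β_W = 2/3`): the row condition is
`e^{ε₀}(1 + 2√2 ε₁)·(3β_W/2) + √2 ε₁ < 1` (`su2_areaLawOnBall_of_row`), certified by exact rational arithmetic (`Real.exp_bound` with two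
Taylor terms, `√2 ≤ 1.415`) at `(β⋆_W, ε₀, ε₁) = (1/3, 1/5, 1/10)` and `(1/2, 2/25, 1/25)` — i.e. Wilson's AREA LAW holds uniformly for every
member of rb-theory's tier-1 ball `ClusterDomainFR ε₀ ε₁ r ∩ IsSlabLocal mv` around the `SU(2)` Wilson action at `β_W = 1/3` (resp. `1/2`),
for every range `r` and vertical diameter `mv ≥ 1` (the rate degrades like `1/(mv · max(2r,1))`, the constants do not depend on the member).
Lossy vertex `ℓ = Λ₀ = ε₁` (DESIGN §6's affine vertex would give larger ε).  Strong-coupling finite-lattice statement; nothing about the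
continuum, a mass gap, or Clay.
-/

noncomputable section

open MeasureTheory ProbabilityTheory
open Literature.MathematicalPhysics.QuantumLattice (fundamentalRep continuous_fundamentalRep fundamentalRep_apply)
open Literature.MathematicalPhysics.QuantumFieldTheory
open Literature.MathematicalPhysics.QuantumFieldTheory.DurhuusFrohlich
open Literature.MathematicalPhysics.QuantumFieldTheory.Balaban1983to89.StrongCouplingDobrushinWindow (OneLinkKRModulus)

namespace Summit.Ventures.YMGap.RobustBall

/-- **SU(2), d = 4 area-law rows on the ball, schematic form** (slice dimension `n = 3`): with the slab modulus `K = 1` on radius `≤ 1`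
(`SlabAreaLawDimensions.su2_oneLinkKRModulus_of_le_one`, slab radius `2n·β_tH = 3β_W/2 ≤ 1`, i.e. `β_W ≤ 2/3`; tree coupling `β = β_W/2`,
't Hooft `β_W/4`) the row condition reads `e^{ε₀}(1 + 2√2 ε₁)·(3β_W/2) + √2 ε₁ < 1`. [folklore] -/
theorem su2_areaLawOnBall_of_row {βW ε₀ ε₁ : ℝ} (hβ : 0 ≤ βW) (hβ1 : 3 * βW / 2 ≤ 1) (h₁ : 0 ≤ ε₁)
    (r : ℕ) {mv : ℕ} (hmv : 1 ≤ mv)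
    (hrow : Real.exp ε₀ * (1 + 2 * Real.sqrt 2 * ε₁) * (3 * βW / 2) + Real.sqrt 2 * ε₁ < 1) :
    AreaLawOnBall 2 (3 + 1) (βW / 2) ε₀ ε₁ r mv := by
  have hmod := SlabAreaLawDimensions.su2_oneLinkKRModulus_of_le_one (R := 3 * βW / 2) hβ1
  have habs : |βW / 2 / (2 : ℕ)| = βW / 4 := by
    rw [abs_of_nonneg (by positivity)]; push_cast; ring
  refine areaLawOnBall_of_oneLinkKRModulus (n := 3) le_rfl (βW / 2) zero_le_one hmod (by rw [habs]; push_cast; linarith)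
    h₁ r hmv ?_
  rw [habs]
  calc Real.exp ε₀ * (1 + 2 * Real.sqrt (2 : ℕ) * ε₁) * (2 * ((3 : ℕ) : ℝ) * (βW / 4) * 1) + Real.sqrt (2 : ℕ) * ε₁
      = Real.exp ε₀ * (1 + 2 * Real.sqrt 2 * ε₁) * (3 * βW / 2) + Real.sqrt 2 * ε₁ := by push_cast; ring
    _ < 1 := hrow

/-- `e^{1/5} ≤ 123/100` (Taylor remainder bound `Real.exp_bound` with two terms). [folklore] -/
theorem exp_one_fifth_le : Real.exp (1 / 5 : ℝ) ≤ 123 / 100 := by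
  have h := Real.exp_bound (x := (1 / 5 : ℝ)) (by norm_num) (n := 2) (by norm_num)
  have hsum : ∑ i ∈ Finset.range 2, (1 / 5 : ℝ) ^ i / (i.factorial : ℝ) = 6 / 5 := by
    simp [Finset.sum_range_succ]; norm_num
  rw [hsum] at h
  have h' := (abs_le.1 h).2
  have : |(1 / 5 : ℝ)| ^ 2 * ((Nat.succ 2 : ℕ) / ((Nat.factorial 2 : ℕ) * (2 : ℕ) : ℝ)) = 3 / 100 := by norm_num [Nat.factorial]
  rw [this] at h'
  linarith

/-- `√2 ≤ 1415/1000`. [folklore] -/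
theorem sqrt_two_le_1415 : Real.sqrt 2 ≤ 1415 / 1000 := by
  rw [show (1415 / 1000 : ℝ) = Real.sqrt ((1415 / 1000) ^ 2) by rw [Real.sqrt_sq]; norm_num]
  exact Real.sqrt_le_sqrt (by norm_num)

/-- **CERTIFIED SU(2), d = 4 AREA-LAW ROW ON THE BALL at `β⋆_W = 1/3`** (tree coupling `β = 1/6`; printed Wilson threshold `1/6`,
the cell's Wilson record `2/3`): for the one-parameter ball `ε₀ = 1/5`, `ε₁ = 1/10` (i.e. `‖W‖ ≤ 1/10` in the design's norm: oscillation load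
`≤ 2ε`, Lipschitz loads `≤ ε`), every range `r` and every vertical diameter `mv ≥ 1`: `AreaLawOnBall 2 3 (1/6) (1/5) (1/10) r mv`.
Row certificate: `e^{1/5}(1 + 2√2/10)(1/2) + √2/10 ≤ 1.23·1.283/2 + 0.1415 < 1` (exact rational arithmetic). [folklore] -/
theorem su2_areaLawOnBall_oneThird (r : ℕ) {mv : ℕ} (hmv : 1 ≤ mv) :
    AreaLawOnBall 2 4 (1 / 6) (1 / 5) (1 / 10) r mv := by
  have h6 : (1 / 6 : ℝ) = 1 / 3 / 2 := by norm_num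
  rw [h6]
  show AreaLawOnBall 2 (3 + 1) _ _ _ r mv
  refine su2_areaLawOnBall_of_row (βW := 1 / 3) (by norm_num) (by norm_num) (by norm_num) r hmv ?_
  have he := exp_one_fifth_le
  have hs := sqrt_two_le_1415
  have hs0 : 0 ≤ Real.sqrt 2 := Real.sqrt_nonneg _
  have he0 : 0 < Real.exp (1 / 5 : ℝ) := Real.exp_pos _
  nlinarith [mul_nonneg he0.le hs0]

/-- **CERTIFIED SU(2), d = 4 AREA-LAW ROW ON THE BALL at `β⋆_W = 1/2`** (tree coupling `1/4`): one-parameter ball `ε₀ = 2/25`, `ε₁ = 1/25`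
(`‖W‖ ≤ 1/25`), every range `r`, every vertical diameter `mv ≥ 1`: `AreaLawOnBall 2 3 (1/4) (2/25) (1/25) r mv`.
Row certificate: `e^{2/25}(1 + 2√2/25)(3/4) + √2/25 < 1`. [folklore] -/
theorem su2_areaLawOnBall_oneHalf (r : ℕ) {mv : ℕ} (hmv : 1 ≤ mv) :
    AreaLawOnBall 2 4 (1 / 4) (2 / 25) (1 / 25) r mv := by
  have h6 : (1 / 4 : ℝ) = 1 / 2 / 2 := by norm_num
  rw [h6]
  show AreaLawOnBall 2 (3 + 1) _ _ _ r mv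
  refine su2_areaLawOnBall_of_row (βW := 1 / 2) (by norm_num) (by norm_num) (by norm_num) r hmv ?_
  have he : Real.exp (2 / 25 : ℝ) ≤ 1085 / 1000 := by
    have h := Real.exp_bound (x := (2 / 25 : ℝ)) (by norm_num) (n := 2) (by norm_num)
    have hsum : ∑ i ∈ Finset.range 2, (2 / 25 : ℝ) ^ i / (i.factorial : ℝ) = 27 / 25 := by
      simp [Finset.sum_range_succ]; norm_num
    rw [hsum] at h
    have h' := (abs_le.1 h).2
    have : |(2 / 25 : ℝ)| ^ 2 * ((Nat.succ 2 : ℕ) / ((Nat.factorial 2 : ℕ) * (2 : ℕ) : ℝ)) = 3 / 625 := by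
      norm_num [Nat.factorial]
    rw [this] at h'
    linarith
  have hs := sqrt_two_le_1415
  have hs0 : 0 ≤ Real.sqrt 2 := Real.sqrt_nonneg _
  have he0 : 0 < Real.exp (2 / 25 : ℝ) := Real.exp_pos _
  nlinarith [mul_nonneg he0.le hs0]


end Summit.Ventures.YMGap.RobustBall
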